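import Summits.CriticalPhenomena.PercolationContinuityZ3.Theorems.PercNearOneGluingAdditiveGluingWholeBlockKernel
import Summits.CriticalPhenomena.PercolationContinuityZ3.Theorems.PercNearOneGluingAdditiveGluingKernelPinDesignated
import HarnessLib

/-! # Crux `PercNearOneGluing.AdditiveGluing` (stmt-CriticalPhenomena-4576) — the whole-block kernel with PER-LAYER
# ADMISSIBLE DESIGNATIONS (exchange-certificate form WB⁺⁺⁺, seat (d) round 3)

Support file (`--supports stmt-CriticalPhenomena-4576`); no definitions, no named facts.  CONDITIONAL result: block goodness
from a certificate.

Setting of the landed whole-block kernel (`wholeBlockKernel_of`, skeleton v7): weighting `u`, relays `A ∋ b`, a block `S` of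
non-relays, the un-glued minimiser `a₀`, the star-killed weighting `u_S` (weight `0` on every pair meeting `S`), the layers
`L_N = {the open outer boundary of S is N}` of the glued weighting `u/S`, and the layer weightings `q_N = (u_S)/N`.  The landed
kernel turns the certificate `Σ_N μ_{u/S}(L_N)·c_N ≥ 0`, `c_N = τ_{q_N}(d) − τ_{q_N}(a₀)` on relay-free layers for ONE FIXED
minimiser `d` of `τ_{u_S}`, into block goodness — and that certificate is refuted (n = 7 witness, Cruxes/…/WB-refuted-c5.md).

`wholeBlockKernel3_of` / `wholeBlockKernel3` accept the finer certificate found by the exchange-certificate census (this seat,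
NOTES/lab t4–t6, certlib.wb3; 0 violations so far incl. both WB witnesses):
* on a relay layer the term is unchanged (`reach_{q_N} − τ_{q_N}(a₀)`, the exact set exchange);
* on a relay-free layer `N ≠ ∅` the designation `d_N ∈ A` may DEPEND ON THE LAYER and need only be a minimiser of SOME
  weighting `w_N` with fewer positive-degree vertices than `u` that agrees with the layer base off the pairs inside `N` and the
  pairs joining `d_N` to `N` (`kernelPin_slack_eq` + glue invariance transport block goodness of `N` at `d_N` from `w_N` to the
  base); and the base may be taken either as `u_S` (term `τ_{q_N}(d_N) − τ_{q_N}(a₀)`) or as `u_S` with the pairs `a₀–N` deleted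
  (term `μ_{u_S}(a₀–N closed) · (τ_{q_N⁻}(d_N) − τ_{q_N⁻}(a₀))`, by `kernelPin_slack_eq` at `a₀`);
* the empty layer keeps `τ_{u_S}(d_∅) − τ_{u_S}(a₀)` with `d_∅` a minimiser of `τ_{u_S}`.
`blockSlack_transfer` is the transport lemma.  [cite: KozmaNitzan2024, §3.2 Thms 4–5 pp. 12–14, Question 9 p. 36]
-/

namespace Summit.CriticalPhenomena.PercolationContinuityZ3.Theorems

open MeasureTheory Set
open Literature.Probability.LatticeModels (prodBernoulli)
open Literature.Probability.Percolation (BondConfig openConn openConnIn openGraph openCluster)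
open scoped BigOperators

noncomputable section
open Classical

section WholeBlockKernel3

open Literature.Probability.LatticeModels Literature.Probability.Percolation

variable {n : ℕ}

/-- **Transport of block goodness between weightings that agree off the block's private pairs.**  If `w` and `v` agree on every
pair that is neither a non-diagonal pair inside `N` nor a pair joining `dN` to `N`, `μ_w(all dN–N pairs closed) > 0`, and the block
`N` is `dN`-good under `w` (worst selection), then it is `dN`-good under `v`.  [cite: KozmaNitzan2024, §3.2 Definition p. 12, p. 14] -/
theorem blockSlack_transfer (v w : Sym2 (Fin n) → unitInterval) (A N : Finset (Fin n)) (b dN : Fin n) (hb : b ∈ A)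
    (hNA : Disjoint N A) (hd : dN ∈ A)
    (hagree : ∀ e : Sym2 (Fin n), ¬ ((∀ y ∈ e, y ∈ N) ∧ ¬ e.IsDiag) → ¬ (dN ∈ e ∧ ∃ y ∈ e, y ∈ N) → w e = v e)
    (hpos : 0 < (prodBernoulli w).real {ω : BondConfig (Fin n) | ∀ y ∈ N, s(dN, y) ∉ ω})
    (hw : (prodBernoulli w).real (openConn dN b)
            + (prodBernoulli w).real ((openConn dN b)ᶜ ∩ (⋃ v ∈ N, openConn dN v) ∩ (⋃ v ∈ N, openConn v b))
          ≤ (prodBernoulli w).real (⋃ v ∈ N, openConn v b)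
            + (∑ W ∈ (Finset.univ : Finset (Finset (Fin n))).filter (fun W => Disjoint W A),
                (prodBernoulli w).real
                    {ω : BondConfig (Fin n) | ∀ z : Fin n, (z ∈ W ↔ ω ∈ ⋃ v ∈ N, openConn v z)}
                  * A.inf' ⟨b, hb⟩ (fun a => (prodBernoulli w).real (openConnIn ((W : Set (Fin n))ᶜ) a b)))) :
    (prodBernoulli v).real (openConn dN b)
            + (prodBernoulli v).real ((openConn dN b)ᶜ ∩ (⋃ v ∈ N, openConn dN v) ∩ (⋃ v ∈ N, openConn v b))
          ≤ (prodBernoulli v).real (⋃ v ∈ N, openConn v b)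
            + (∑ W ∈ (Finset.univ : Finset (Finset (Fin n))).filter (fun W => Disjoint W A),
                (prodBernoulli v).real
                    {ω : BondConfig (Fin n) | ∀ z : Fin n, (z ∈ W ↔ ω ∈ ⋃ v ∈ N, openConn v z)}
                  * A.inf' ⟨b, hb⟩ (fun a => (prodBernoulli v).real (openConnIn ((W : Set (Fin n))ᶜ) a b))) := by
  have s1 := kernelPin_slack_eq w A N b dN hb hNA hd
  have s2 := kernelPin_slack_eq v A N b dN hb hNA hd
  have h1 := sub_nonneg.2 hw
  rw [s1] at h1
  have h2 := (mul_nonneg_iff_of_pos_left hpos).1 h1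
  rw [← blockGrowth_glue_real_openConn (fun e : Sym2 (Fin n) => if dN ∈ e ∧ (∃ y ∈ e, y ∈ N) then (0 : unitInterval) else w e) N dN b,
    ← blockGrowth_glue_real_iUnion (fun e : Sym2 (Fin n) => if dN ∈ e ∧ (∃ y ∈ e, y ∈ N) then (0 : unitInterval) else w e) N b,
    ← bk_pockets_glue (fun e : Sym2 (Fin n) => if dN ∈ e ∧ (∃ y ∈ e, y ∈ N) then (0 : unitInterval) else w e) A N b hb] at h2
  have hfun : (fun e : Sym2 (Fin n) => if (∀ x ∈ e, x ∈ N) ∧ ¬ e.IsDiag then (1 : unitInterval) else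
        if dN ∈ e ∧ (∃ y ∈ e, y ∈ N) then (0 : unitInterval) else w e)
      = (fun e : Sym2 (Fin n) => if (∀ x ∈ e, x ∈ N) ∧ ¬ e.IsDiag then (1 : unitInterval) else
        if dN ∈ e ∧ (∃ y ∈ e, y ∈ N) then (0 : unitInterval) else v e) := by
    funext e
    by_cases hc1 : (∀ x ∈ e, x ∈ N) ∧ ¬ e.IsDiag
    · rw [if_pos hc1, if_pos hc1]
    · rw [if_neg hc1, if_neg hc1]
      by_cases hc2 : dN ∈ e ∧ ∃ y ∈ e, y ∈ N
      · rw [if_pos hc2, if_pos hc2]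
      · rw [if_neg hc2, if_neg hc2]
        exact hagree e hc1 hc2
  rw [hfun] at h2
  rw [blockGrowth_glue_real_openConn (fun e : Sym2 (Fin n) => if dN ∈ e ∧ (∃ y ∈ e, y ∈ N) then (0 : unitInterval) else v e) N dN b,
    blockGrowth_glue_real_iUnion (fun e : Sym2 (Fin n) => if dN ∈ e ∧ (∃ y ∈ e, y ∈ N) then (0 : unitInterval) else v e) N b,
    bk_pockets_glue (fun e : Sym2 (Fin n) => if dN ∈ e ∧ (∃ y ∈ e, y ∈ N) then (0 : unitInterval) else v e) A N b hb] at h2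
  have h3 : 0 ≤ (prodBernoulli v).real (⋃ v ∈ N, openConn v b)
        + (∑ W ∈ (Finset.univ : Finset (Finset (Fin n))).filter (fun W => Disjoint W A),
                (prodBernoulli v).real
                    {ω : BondConfig (Fin n) | ∀ z : Fin n, (z ∈ W ↔ ω ∈ ⋃ v ∈ N, openConn v z)}
                  * A.inf' ⟨b, hb⟩ (fun a => (prodBernoulli v).real (openConnIn ((W : Set (Fin n))ᶜ) a b)))
        - ((prodBernoulli v).real (openConn dN b) + (prodBernoulli v).real ((openConn dN b)ᶜ ∩ (⋃ v ∈ N, openConn dN v) ∩ (⋃ v ∈ N, openConn v b))) := by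
    rw [s2]
    exact mul_nonneg measureReal_nonneg h2
  exact sub_nonneg.1 h3

/-- **The whole-block kernel with per-layer admissible designations** (from its ingredients: the three whole-block
σ-identities, the isolated-block lemma, `HBLK`, and the WB⁺⁺⁺ certificate).  See the module docstring.
[cite: KozmaNitzan2024, §3.2 Thms 4–5 pp. 12–14] -/
theorem wholeBlockKernel3_of
    (hR : ∀ (n : ℕ) (u : Sym2 (Fin n) → unitInterval) (S : Finset (Fin n)) (b : Fin n), b ∉ S →
        (prodBernoulli (fun e : Sym2 (Fin n) => if (∀ y ∈ e, y ∈ S) ∧ ¬ e.IsDiag then 1 else u e)).real (⋃ v ∈ S, openConn v b)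
          = ∑ N : Finset (Fin n), (prodBernoulli (fun e : Sym2 (Fin n) => if (∀ y ∈ e, y ∈ S) ∧ ¬ e.IsDiag then 1 else u e)).real {ω : BondConfig (Fin n) | ∀ y : Fin n, y ∈ N ↔ (y ∉ S ∧ ∃ o ∈ S, s(o, y) ∈ ω)}
              * (prodBernoulli (fun e : Sym2 (Fin n) => if (∀ y ∈ e, y ∈ N) ∧ ¬ e.IsDiag then 1 else if (∃ y ∈ e, y ∈ S) then 0 else u e)).real (⋃ v ∈ N, openConn v b))
    (hD : ∀ (n : ℕ) (u : Sym2 (Fin n) → unitInterval) (S : Finset (Fin n)) (d b : Fin n), d ∉ S → b ∉ S →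
        (prodBernoulli (fun e : Sym2 (Fin n) => if (∀ y ∈ e, y ∈ S) ∧ ¬ e.IsDiag then 1 else u e)).real (openConn d b)
          = ∑ N : Finset (Fin n), (prodBernoulli (fun e : Sym2 (Fin n) => if (∀ y ∈ e, y ∈ S) ∧ ¬ e.IsDiag then 1 else u e)).real {ω : BondConfig (Fin n) | ∀ y : Fin n, y ∈ N ↔ (y ∉ S ∧ ∃ o ∈ S, s(o, y) ∈ ω)}
              * (prodBernoulli (fun e : Sym2 (Fin n) => if (∀ y ∈ e, y ∈ N) ∧ ¬ e.IsDiag then 1 else if (∃ y ∈ e, y ∈ S) then 0 else u e)).real (openConn d b))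
    (hP : ∀ (n : ℕ) (u : Sym2 (Fin n) → unitInterval) (A S : Finset (Fin n)) (b : Fin n) (hb : b ∈ A), Disjoint S A →
        (∑ W ∈ (Finset.univ : Finset (Finset (Fin n))).filter (fun W => Disjoint W A),
                (prodBernoulli (fun e : Sym2 (Fin n) => if (∀ y ∈ e, y ∈ S) ∧ ¬ e.IsDiag then 1 else u e)).real
                    {ω : BondConfig (Fin n) | ∀ z : Fin n, (z ∈ W ↔ ω ∈ ⋃ v ∈ S, openConn v z)}
                  * A.inf' ⟨b, hb⟩ (fun a => (prodBernoulli (fun e : Sym2 (Fin n) => if (∀ y ∈ e, y ∈ S) ∧ ¬ e.IsDiag then 1 else u e)).real (openConnIn ((W : Set (Fin n))ᶜ) a b)))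
          = ∑ N : Finset (Fin n), (prodBernoulli (fun e : Sym2 (Fin n) => if (∀ y ∈ e, y ∈ S) ∧ ¬ e.IsDiag then 1 else u e)).real {ω : BondConfig (Fin n) | ∀ y : Fin n, y ∈ N ↔ (y ∉ S ∧ ∃ o ∈ S, s(o, y) ∈ ω)}
              * (∑ W ∈ (Finset.univ : Finset (Finset (Fin n))).filter (fun W => Disjoint W A),
                (prodBernoulli (fun e : Sym2 (Fin n) => if (∀ y ∈ e, y ∈ N) ∧ ¬ e.IsDiag then 1 else if (∃ y ∈ e, y ∈ S) then 0 else u e)).real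
                    {ω : BondConfig (Fin n) | ∀ z : Fin n, (z ∈ W ↔ ω ∈ ⋃ v ∈ N, openConn v z)}
                  * A.inf' ⟨b, hb⟩ (fun a => (prodBernoulli (fun e : Sym2 (Fin n) => if (∀ y ∈ e, y ∈ N) ∧ ¬ e.IsDiag then 1 else if (∃ y ∈ e, y ∈ S) then 0 else u e)).real (openConnIn ((W : Set (Fin n))ᶜ) a b))))
    (hIso : ∀ (n : ℕ) (u : Sym2 (Fin n) → unitInterval) (A S : Finset (Fin n)) (b a₀ : Fin n) (hb : b ∈ A),
        Disjoint S A → a₀ ∈ A →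
        (∀ a ∈ A, (prodBernoulli u).real (openConn a₀ b) ≤ (prodBernoulli u).real (openConn a b)) →
        (∀ v ∈ S, ∀ y : Fin n, (u s(y, v) : ℝ) = 0) →
        (prodBernoulli u).real (openConn a₀ b)
            + (prodBernoulli u).real ((openConn a₀ b)ᶜ ∩ (⋃ v ∈ S, openConn a₀ v) ∩ (⋃ v ∈ S, openConn v b))
          ≤ (prodBernoulli u).real (⋃ v ∈ S, openConn v b)
            + (∑ W ∈ (Finset.univ : Finset (Finset (Fin n))).filter (fun W => Disjoint W A),
                (prodBernoulli u).real
                    {ω : BondConfig (Fin n) | ∀ z : Fin n, (z ∈ W ↔ ω ∈ ⋃ v ∈ S, openConn v z)}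
                  * A.inf' ⟨b, hb⟩ (fun a => (prodBernoulli u).real (openConnIn ((W : Set (Fin n))ᶜ) a b)))) :
    ∀ (n : ℕ) (u : Sym2 (Fin n) → unitInterval) (A S : Finset (Fin n)) (b a₀ : Fin n) (hb : b ∈ A)
      (d : Finset (Fin n) → Fin n) (w : Finset (Fin n) → Sym2 (Fin n) → unitInterval) (modeB : Finset (Fin n) → Bool),
      Disjoint S A → a₀ ∈ A →
      (∀ a ∈ A, (prodBernoulli u).real (openConn a₀ b) ≤ (prodBernoulli u).real (openConn a b)) →
      (∀ N : Finset (Fin n), d N ∈ A) →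
      modeB ∅ = false →
      (∀ a ∈ A, (prodBernoulli (fun e : Sym2 (Fin n) => if (∃ y ∈ e, y ∈ S) then (0 : unitInterval) else u e)).real (openConn (d ∅) b) ≤ (prodBernoulli (fun e : Sym2 (Fin n) => if (∃ y ∈ e, y ∈ S) then (0 : unitInterval) else u e)).real (openConn a b)) →
      (∀ N : Finset (Fin n), Disjoint N A → N.Nonempty → (prodBernoulli (fun e : Sym2 (Fin n) => if (∀ y ∈ e, y ∈ S) ∧ ¬ e.IsDiag then 1 else u e)).real {ω : BondConfig (Fin n) | ∀ y : Fin n, y ∈ N ↔ (y ∉ S ∧ ∃ o ∈ S, s(o, y) ∈ ω)} ≠ 0 →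
        ∀ a ∈ A, (prodBernoulli (w N)).real (openConn (d N) b) ≤ (prodBernoulli (w N)).real (openConn a b)) →
      (∀ N : Finset (Fin n), Disjoint N A → N.Nonempty → (prodBernoulli (fun e : Sym2 (Fin n) => if (∀ y ∈ e, y ∈ S) ∧ ¬ e.IsDiag then 1 else u e)).real {ω : BondConfig (Fin n) | ∀ y : Fin n, y ∈ N ↔ (y ∉ S ∧ ∃ o ∈ S, s(o, y) ∈ ω)} ≠ 0 →
        (Finset.univ.filter (fun v : Fin n => ∃ y : Fin n, 0 < (w N s(y, v) : ℝ))).card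
          < (Finset.univ.filter (fun v : Fin n => ∃ y : Fin n, 0 < (u s(y, v) : ℝ))).card) →
      (∀ N : Finset (Fin n), Disjoint N A → N.Nonempty → (prodBernoulli (fun e : Sym2 (Fin n) => if (∀ y ∈ e, y ∈ S) ∧ ¬ e.IsDiag then 1 else u e)).real {ω : BondConfig (Fin n) | ∀ y : Fin n, y ∈ N ↔ (y ∉ S ∧ ∃ o ∈ S, s(o, y) ∈ ω)} ≠ 0 → ∀ e : Sym2 (Fin n),
        ¬ ((∀ y ∈ e, y ∈ N) ∧ ¬ e.IsDiag) → ¬ (d N ∈ e ∧ ∃ y ∈ e, y ∈ N) →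
        w N e = (if modeB N = true then (fun e : Sym2 (Fin n) => if a₀ ∈ e ∧ (∃ y ∈ e, y ∈ N) then (0 : unitInterval) else if (∃ y ∈ e, y ∈ S) then 0 else u e) e else (fun e : Sym2 (Fin n) => if (∃ y ∈ e, y ∈ S) then (0 : unitInterval) else u e) e)) →
      (∀ N : Finset (Fin n), Disjoint N A → N.Nonempty → (prodBernoulli (fun e : Sym2 (Fin n) => if (∀ y ∈ e, y ∈ S) ∧ ¬ e.IsDiag then 1 else u e)).real {ω : BondConfig (Fin n) | ∀ y : Fin n, y ∈ N ↔ (y ∉ S ∧ ∃ o ∈ S, s(o, y) ∈ ω)} ≠ 0 →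
        0 < (prodBernoulli (w N)).real {ω : BondConfig (Fin n) | ∀ y ∈ N, s(d N, y) ∉ ω}) →
      (∀ w' : Sym2 (Fin n) → unitInterval,
        (Finset.univ.filter (fun v : Fin n => ∃ y : Fin n, 0 < (w' s(y, v) : ℝ))).card
          < (Finset.univ.filter (fun v : Fin n => ∃ y : Fin n, 0 < (u s(y, v) : ℝ))).card →
        ∀ (A' S' : Finset (Fin n)) (b' d' : Fin n) (hb' : b' ∈ A'), Disjoint S' A' → d' ∈ A' →
        (∀ a ∈ A', (prodBernoulli w').real (openConn d' b') ≤ (prodBernoulli w').real (openConn a b')) →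
        (prodBernoulli w').real (openConn d' b')
          + (prodBernoulli w').real
              ((openConn d' b')ᶜ ∩ (⋃ v ∈ S', openConn d' v) ∩ (⋃ v ∈ S', openConn v b'))
        ≤ (prodBernoulli w').real (⋃ v ∈ S', openConn v b')
          + (∑ W ∈ (Finset.univ : Finset (Finset (Fin n))).filter (fun W => Disjoint W A'),
              (prodBernoulli w').real
                  {ω : BondConfig (Fin n) | ∀ z : Fin n, (z ∈ W ↔ ω ∈ ⋃ v ∈ S', openConn v z)}
                * A'.inf' ⟨b', hb'⟩ (fun a => (prodBernoulli w').real (openConnIn ((W : Set (Fin n))ᶜ) a b')))) →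
      0 ≤ ∑ N : Finset (Fin n), (prodBernoulli (fun e : Sym2 (Fin n) => if (∀ y ∈ e, y ∈ S) ∧ ¬ e.IsDiag then 1 else u e)).real {ω : BondConfig (Fin n) | ∀ y : Fin n, y ∈ N ↔ (y ∉ S ∧ ∃ o ∈ S, s(o, y) ∈ ω)}
          * (if Disjoint N A then
              (if modeB N = true then
                  (prodBernoulli (fun e : Sym2 (Fin n) => if (∃ y ∈ e, y ∈ S) then (0 : unitInterval) else u e)).real {ω : BondConfig (Fin n) | ∀ y ∈ N, s(a₀, y) ∉ ω}
                    * ((prodBernoulli (fun e : Sym2 (Fin n) => if (∀ y ∈ e, y ∈ N) ∧ ¬ e.IsDiag then 1 else if a₀ ∈ e ∧ (∃ y ∈ e, y ∈ N) then (0 : unitInterval) else if (∃ y ∈ e, y ∈ S) then 0 else u e)).real (openConn (d N) b) - (prodBernoulli (fun e : Sym2 (Fin n) => if (∀ y ∈ e, y ∈ N) ∧ ¬ e.IsDiag then 1 else if a₀ ∈ e ∧ (∃ y ∈ e, y ∈ N) then (0 : unitInterval) else if (∃ y ∈ e, y ∈ S) then 0 else u e)).real (openConn a₀ b))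
                else ((prodBernoulli (fun e : Sym2 (Fin n) => if (∀ y ∈ e, y ∈ N) ∧ ¬ e.IsDiag then 1 else if (∃ y ∈ e, y ∈ S) then 0 else u e)).real (openConn (d N) b) - (prodBernoulli (fun e : Sym2 (Fin n) => if (∀ y ∈ e, y ∈ N) ∧ ¬ e.IsDiag then 1 else if (∃ y ∈ e, y ∈ S) then 0 else u e)).real (openConn a₀ b)))
            else
              ((prodBernoulli (fun e : Sym2 (Fin n) => if (∀ y ∈ e, y ∈ N) ∧ ¬ e.IsDiag then 1 else if (∃ y ∈ e, y ∈ S) then 0 else u e)).real (⋃ v ∈ N, openConn v b) - (prodBernoulli (fun e : Sym2 (Fin n) => if (∀ y ∈ e, y ∈ N) ∧ ¬ e.IsDiag then 1 else if (∃ y ∈ e, y ∈ S) then 0 else u e)).real (openConn a₀ b))) →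
      (prodBernoulli u).real (openConn a₀ b)
            + (prodBernoulli u).real ((openConn a₀ b)ᶜ ∩ (⋃ v ∈ S, openConn a₀ v) ∩ (⋃ v ∈ S, openConn v b))
          ≤ (prodBernoulli u).real (⋃ v ∈ S, openConn v b)
            + (∑ W ∈ (Finset.univ : Finset (Finset (Fin n))).filter (fun W => Disjoint W A),
                (prodBernoulli u).real
                    {ω : BondConfig (Fin n) | ∀ z : Fin n, (z ∈ W ↔ ω ∈ ⋃ v ∈ S, openConn v z)}
                  * A.inf' ⟨b, hb⟩ (fun a => (prodBernoulli u).real (openConnIn ((W : Set (Fin n))ᶜ) a b))) := by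
  intro n u A S b a₀ hb d w modeB hSA ha₀ hmin hdA hmode0 hd0 hwmin hwcard hwagree hwpos hblk hsum
  -- the degenerate case: every vertex of the block is isolated
  by_cases hiso : ∀ v ∈ S, ∀ y : Fin n, (u s(y, v) : ℝ) = 0
  · exact hIso n u A S b a₀ hb hSA ha₀ hmin hiso
  have hbS : b ∉ S := fun h => Finset.disjoint_left.1 hSA h hb
  have ha₀S : a₀ ∉ S := fun h => Finset.disjoint_left.1 hSA h ha₀
  -- (1) glue the block
  rw [← blockGrowth_glue_real_openConn u S a₀ b, ← blockGrowth_glue_real_iUnion u S b,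
    ← bk_pockets_glue u A S b hb]
  -- (2) expand over the layers
  rw [hD n u S a₀ b ha₀S hbS, hR n u S b hbS, hP n u A S b hb hSA]
  -- (3) termwise comparison with the certificate
  have hterm : ∀ N : Finset (Fin n),
      (prodBernoulli (fun e : Sym2 (Fin n) => if (∀ y ∈ e, y ∈ S) ∧ ¬ e.IsDiag then 1 else u e)).real {ω : BondConfig (Fin n) | ∀ y : Fin n, y ∈ N ↔ (y ∉ S ∧ ∃ o ∈ S, s(o, y) ∈ ω)}
          * (if Disjoint N A then
              (if modeB N = true then
                  (prodBernoulli (fun e : Sym2 (Fin n) => if (∃ y ∈ e, y ∈ S) then (0 : unitInterval) else u e)).real {ω : BondConfig (Fin n) | ∀ y ∈ N, s(a₀, y) ∉ ω}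
                    * ((prodBernoulli (fun e : Sym2 (Fin n) => if (∀ y ∈ e, y ∈ N) ∧ ¬ e.IsDiag then 1 else if a₀ ∈ e ∧ (∃ y ∈ e, y ∈ N) then (0 : unitInterval) else if (∃ y ∈ e, y ∈ S) then 0 else u e)).real (openConn (d N) b) - (prodBernoulli (fun e : Sym2 (Fin n) => if (∀ y ∈ e, y ∈ N) ∧ ¬ e.IsDiag then 1 else if a₀ ∈ e ∧ (∃ y ∈ e, y ∈ N) then (0 : unitInterval) else if (∃ y ∈ e, y ∈ S) then 0 else u e)).real (openConn a₀ b))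
                else ((prodBernoulli (fun e : Sym2 (Fin n) => if (∀ y ∈ e, y ∈ N) ∧ ¬ e.IsDiag then 1 else if (∃ y ∈ e, y ∈ S) then 0 else u e)).real (openConn (d N) b) - (prodBernoulli (fun e : Sym2 (Fin n) => if (∀ y ∈ e, y ∈ N) ∧ ¬ e.IsDiag then 1 else if (∃ y ∈ e, y ∈ S) then 0 else u e)).real (openConn a₀ b)))
            else
              ((prodBernoulli (fun e : Sym2 (Fin n) => if (∀ y ∈ e, y ∈ N) ∧ ¬ e.IsDiag then 1 else if (∃ y ∈ e, y ∈ S) then 0 else u e)).real (⋃ v ∈ N, openConn v b) - (prodBernoulli (fun e : Sym2 (Fin n) => if (∀ y ∈ e, y ∈ N) ∧ ¬ e.IsDiag then 1 else if (∃ y ∈ e, y ∈ S) then 0 else u e)).real (openConn a₀ b)))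
        ≤ (prodBernoulli (fun e : Sym2 (Fin n) => if (∀ y ∈ e, y ∈ S) ∧ ¬ e.IsDiag then 1 else u e)).real {ω : BondConfig (Fin n) | ∀ y : Fin n, y ∈ N ↔ (y ∉ S ∧ ∃ o ∈ S, s(o, y) ∈ ω)}
            * (prodBernoulli (fun e : Sym2 (Fin n) => if (∀ y ∈ e, y ∈ N) ∧ ¬ e.IsDiag then 1 else if (∃ y ∈ e, y ∈ S) then 0 else u e)).real (⋃ v ∈ N, openConn v b)
          + (prodBernoulli (fun e : Sym2 (Fin n) => if (∀ y ∈ e, y ∈ S) ∧ ¬ e.IsDiag then 1 else u e)).real {ω : BondConfig (Fin n) | ∀ y : Fin n, y ∈ N ↔ (y ∉ S ∧ ∃ o ∈ S, s(o, y) ∈ ω)}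
            * (∑ W ∈ (Finset.univ : Finset (Finset (Fin n))).filter (fun W => Disjoint W A),
                (prodBernoulli (fun e : Sym2 (Fin n) => if (∀ y ∈ e, y ∈ N) ∧ ¬ e.IsDiag then 1 else if (∃ y ∈ e, y ∈ S) then 0 else u e)).real
                    {ω : BondConfig (Fin n) | ∀ z : Fin n, (z ∈ W ↔ ω ∈ ⋃ v ∈ N, openConn v z)}
                  * A.inf' ⟨b, hb⟩ (fun a => (prodBernoulli (fun e : Sym2 (Fin n) => if (∀ y ∈ e, y ∈ N) ∧ ¬ e.IsDiag then 1 else if (∃ y ∈ e, y ∈ S) then 0 else u e)).real (openConnIn ((W : Set (Fin n))ᶜ) a b)))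
          - (prodBernoulli (fun e : Sym2 (Fin n) => if (∀ y ∈ e, y ∈ S) ∧ ¬ e.IsDiag then 1 else u e)).real {ω : BondConfig (Fin n) | ∀ y : Fin n, y ∈ N ↔ (y ∉ S ∧ ∃ o ∈ S, s(o, y) ∈ ω)}
            * (prodBernoulli (fun e : Sym2 (Fin n) => if (∀ y ∈ e, y ∈ N) ∧ ¬ e.IsDiag then 1 else if (∃ y ∈ e, y ∈ S) then 0 else u e)).real (openConn a₀ b) := by
    intro N
    set m : ℝ := (prodBernoulli (fun e : Sym2 (Fin n) => if (∀ y ∈ e, y ∈ S) ∧ ¬ e.IsDiag then 1 else u e)).real {ω : BondConfig (Fin n) | ∀ y : Fin n, y ∈ N ↔ (y ∉ S ∧ ∃ o ∈ S, s(o, y) ∈ ω)} with hm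
    have hm0 : 0 ≤ m := measureReal_nonneg
    have hpk0 : 0 ≤ (∑ W ∈ (Finset.univ : Finset (Finset (Fin n))).filter (fun W => Disjoint W A),
                (prodBernoulli (fun e : Sym2 (Fin n) => if (∀ y ∈ e, y ∈ N) ∧ ¬ e.IsDiag then 1 else if (∃ y ∈ e, y ∈ S) then 0 else u e)).real
                    {ω : BondConfig (Fin n) | ∀ z : Fin n, (z ∈ W ↔ ω ∈ ⋃ v ∈ N, openConn v z)}
                  * A.inf' ⟨b, hb⟩ (fun a => (prodBernoulli (fun e : Sym2 (Fin n) => if (∀ y ∈ e, y ∈ N) ∧ ¬ e.IsDiag then 1 else if (∃ y ∈ e, y ∈ S) then 0 else u e)).real (openConnIn ((W : Set (Fin n))ᶜ) a b))) :=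
      Finset.sum_nonneg fun W _ => mul_nonneg measureReal_nonneg (Finset.le_inf' _ _ fun a _ => measureReal_nonneg)
    suffices hbr : (if Disjoint N A then
              (if modeB N = true then
                  (prodBernoulli (fun e : Sym2 (Fin n) => if (∃ y ∈ e, y ∈ S) then (0 : unitInterval) else u e)).real {ω : BondConfig (Fin n) | ∀ y ∈ N, s(a₀, y) ∉ ω}
                    * ((prodBernoulli (fun e : Sym2 (Fin n) => if (∀ y ∈ e, y ∈ N) ∧ ¬ e.IsDiag then 1 else if a₀ ∈ e ∧ (∃ y ∈ e, y ∈ N) then (0 : unitInterval) else if (∃ y ∈ e, y ∈ S) then 0 else u e)).real (openConn (d N) b) - (prodBernoulli (fun e : Sym2 (Fin n) => if (∀ y ∈ e, y ∈ N) ∧ ¬ e.IsDiag then 1 else if a₀ ∈ e ∧ (∃ y ∈ e, y ∈ N) then (0 : unitInterval) else if (∃ y ∈ e, y ∈ S) then 0 else u e)).real (openConn a₀ b))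
                else ((prodBernoulli (fun e : Sym2 (Fin n) => if (∀ y ∈ e, y ∈ N) ∧ ¬ e.IsDiag then 1 else if (∃ y ∈ e, y ∈ S) then 0 else u e)).real (openConn (d N) b) - (prodBernoulli (fun e : Sym2 (Fin n) => if (∀ y ∈ e, y ∈ N) ∧ ¬ e.IsDiag then 1 else if (∃ y ∈ e, y ∈ S) then 0 else u e)).real (openConn a₀ b)))
            else
              ((prodBernoulli (fun e : Sym2 (Fin n) => if (∀ y ∈ e, y ∈ N) ∧ ¬ e.IsDiag then 1 else if (∃ y ∈ e, y ∈ S) then 0 else u e)).real (⋃ v ∈ N, openConn v b) - (prodBernoulli (fun e : Sym2 (Fin n) => if (∀ y ∈ e, y ∈ N) ∧ ¬ e.IsDiag then 1 else if (∃ y ∈ e, y ∈ S) then 0 else u e)).real (openConn a₀ b)))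
        ≤ (prodBernoulli (fun e : Sym2 (Fin n) => if (∀ y ∈ e, y ∈ N) ∧ ¬ e.IsDiag then 1 else if (∃ y ∈ e, y ∈ S) then 0 else u e)).real (⋃ v ∈ N, openConn v b)
          + (∑ W ∈ (Finset.univ : Finset (Finset (Fin n))).filter (fun W => Disjoint W A),
                (prodBernoulli (fun e : Sym2 (Fin n) => if (∀ y ∈ e, y ∈ N) ∧ ¬ e.IsDiag then 1 else if (∃ y ∈ e, y ∈ S) then 0 else u e)).real
                    {ω : BondConfig (Fin n) | ∀ z : Fin n, (z ∈ W ↔ ω ∈ ⋃ v ∈ N, openConn v z)}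
                  * A.inf' ⟨b, hb⟩ (fun a => (prodBernoulli (fun e : Sym2 (Fin n) => if (∀ y ∈ e, y ∈ N) ∧ ¬ e.IsDiag then 1 else if (∃ y ∈ e, y ∈ S) then 0 else u e)).real (openConnIn ((W : Set (Fin n))ᶜ) a b)))
          - (prodBernoulli (fun e : Sym2 (Fin n) => if (∀ y ∈ e, y ∈ N) ∧ ¬ e.IsDiag then 1 else if (∃ y ∈ e, y ∈ S) then 0 else u e)).real (openConn a₀ b) ∨ m = 0 by
      rcases hbr with hbr | hm00
      · have := mul_le_mul_of_nonneg_left hbr hm0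
        nlinarith [this]
      · rw [hm00]
        simp only [zero_mul, add_zero, sub_zero, le_refl]
    by_cases hmz : m = 0
    · exact Or.inr hmz
    refine Or.inl ?_
    split_ifs with hNA hmode
    · -- relay-free layer, base with the a₀–N pairs deleted (mode B)
      have hN0 : N ≠ ∅ := by
        rintro rfl
        rw [hmode0] at hmode
        exact Bool.false_ne_true hmode
      have hNne : N.Nonempty := Finset.nonempty_iff_ne_empty.2 hN0
      -- block goodness of `N` at `d N` under the base `u_S⁻`
      have hgoodw := hblk (w N) (hwcard N hNA hNne hmz) A N b (d N) hb hNA (hdA N) (hwmin N hNA hNne hmz)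
      have hag : ∀ e : Sym2 (Fin n), ¬ ((∀ y ∈ e, y ∈ N) ∧ ¬ e.IsDiag) → ¬ (d N ∈ e ∧ ∃ y ∈ e, y ∈ N) →
          w N e = (fun e : Sym2 (Fin n) => if a₀ ∈ e ∧ (∃ y ∈ e, y ∈ N) then (0 : unitInterval) else if (∃ y ∈ e, y ∈ S) then 0 else u e) e := by
        intro e h1 h2
        rw [hwagree N hNA hNne hmz e h1 h2, if_pos hmode]
      have hgood := blockSlack_transfer (fun e : Sym2 (Fin n) => if a₀ ∈ e ∧ (∃ y ∈ e, y ∈ N) then (0 : unitInterval) else if (∃ y ∈ e, y ∈ S) then 0 else u e) (w N) A N b (d N) hb hNA (hdA N) hag (hwpos N hNA hNne hmz) hgoodw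
      -- the slack of `N` at `a₀` under `u_S` is `c_N ·` the slack under `u_S⁻`
      have hpin := kernelPin_slack_eq (fun e : Sym2 (Fin n) => if (∃ y ∈ e, y ∈ S) then (0 : unitInterval) else u e) A N b a₀ hb hNA ha₀
      have hc0 : 0 ≤ (prodBernoulli (fun e : Sym2 (Fin n) => if (∃ y ∈ e, y ∈ S) then (0 : unitInterval) else u e)).real {ω : BondConfig (Fin n) | ∀ y ∈ N, s(a₀, y) ∉ ω} := measureReal_nonneg
      -- designated reliabilities of the glued layer block
      have hgd := blockGrowth_glue_real_openConn (fun e : Sym2 (Fin n) => if a₀ ∈ e ∧ (∃ y ∈ e, y ∈ N) then (0 : unitInterval) else if (∃ y ∈ e, y ∈ S) then 0 else u e) N (d N) b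
      have hga := blockGrowth_glue_real_openConn (fun e : Sym2 (Fin n) => if a₀ ∈ e ∧ (∃ y ∈ e, y ∈ N) then (0 : unitInterval) else if (∃ y ∈ e, y ∈ S) then 0 else u e) N a₀ b
      have hg1 := blockGrowth_glue_real_openConn (fun e : Sym2 (Fin n) => if (∃ y ∈ e, y ∈ S) then (0 : unitInterval) else u e) N a₀ b
      have hg2 := blockGrowth_glue_real_iUnion (fun e : Sym2 (Fin n) => if (∃ y ∈ e, y ∈ S) then (0 : unitInterval) else u e) N b
      have hg3 := bk_pockets_glue (fun e : Sym2 (Fin n) => if (∃ y ∈ e, y ∈ S) then (0 : unitInterval) else u e) A N b hb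
      rw [hgd, hga]
      rw [← hg1, ← hg2, ← hg3] at hpin
      have hkey : (prodBernoulli (fun e : Sym2 (Fin n) => if (∃ y ∈ e, y ∈ S) then (0 : unitInterval) else u e)).real {ω : BondConfig (Fin n) | ∀ y ∈ N, s(a₀, y) ∉ ω}
            * (((prodBernoulli (fun e : Sym2 (Fin n) => if a₀ ∈ e ∧ (∃ y ∈ e, y ∈ N) then (0 : unitInterval) else if (∃ y ∈ e, y ∈ S) then 0 else u e)).real (openConn (d N) b) + (prodBernoulli (fun e : Sym2 (Fin n) => if a₀ ∈ e ∧ (∃ y ∈ e, y ∈ N) then (0 : unitInterval) else if (∃ y ∈ e, y ∈ S) then 0 else u e)).real ((openConn (d N) b)ᶜ ∩ (⋃ v ∈ N, openConn (d N) v) ∩ (⋃ v ∈ N, openConn v b))) - ((prodBernoulli (fun e : Sym2 (Fin n) => if a₀ ∈ e ∧ (∃ y ∈ e, y ∈ N) then (0 : unitInterval) else if (∃ y ∈ e, y ∈ S) then 0 else u e)).real (openConn a₀ b) + (prodBernoulli (fun e : Sym2 (Fin n) => if a₀ ∈ e ∧ (∃ y ∈ e, y ∈ N) then (0 : unitInterval)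 else if (∃ y ∈ e, y ∈ S) then 0 else u e)).real ((openConn a₀ b)ᶜ ∩ (⋃ v ∈ N, openConn a₀ v) ∩ (⋃ v ∈ N, openConn v b))))
          ≤ (prodBernoulli (fun e : Sym2 (Fin n) => if (∃ y ∈ e, y ∈ S) then (0 : unitInterval) else u e)).real {ω : BondConfig (Fin n) | ∀ y ∈ N, s(a₀, y) ∉ ω} * ((prodBernoulli (fun e : Sym2 (Fin n) => if a₀ ∈ e ∧ (∃ y ∈ e, y ∈ N) then (0 : unitInterval) else if (∃ y ∈ e, y ∈ S) then 0 else u e)).real (⋃ v ∈ N, openConn v b)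
        + (∑ W ∈ (Finset.univ : Finset (Finset (Fin n))).filter (fun W => Disjoint W A),
                (prodBernoulli (fun e : Sym2 (Fin n) => if a₀ ∈ e ∧ (∃ y ∈ e, y ∈ N) then (0 : unitInterval) else if (∃ y ∈ e, y ∈ S) then 0 else u e)).real
                    {ω : BondConfig (Fin n) | ∀ z : Fin n, (z ∈ W ↔ ω ∈ ⋃ v ∈ N, openConn v z)}
                  * A.inf' ⟨b, hb⟩ (fun a => (prodBernoulli (fun e : Sym2 (Fin n) => if a₀ ∈ e ∧ (∃ y ∈ e, y ∈ N) then (0 : unitInterval) else if (∃ y ∈ e, y ∈ S) then 0 else u e)).real (openConnIn ((W : Set (Fin n))ᶜ) a b)))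
        - ((prodBernoulli (fun e : Sym2 (Fin n) => if a₀ ∈ e ∧ (∃ y ∈ e, y ∈ N) then (0 : unitInterval) else if (∃ y ∈ e, y ∈ S) then 0 else u e)).real (openConn a₀ b) + (prodBernoulli (fun e : Sym2 (Fin n) => if a₀ ∈ e ∧ (∃ y ∈ e, y ∈ N) then (0 : unitInterval) else if (∃ y ∈ e, y ∈ S) then 0 else u e)).real ((openConn a₀ b)ᶜ ∩ (⋃ v ∈ N, openConn a₀ v) ∩ (⋃ v ∈ N, openConn v b)))) := by
        refine mul_le_mul_of_nonneg_left ?_ hc0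
        linarith [hgood]
      linarith [hkey, hpin]
    · -- relay-free layer, base `u_S` (mode A)
      by_cases hN0 : N = ∅
      · -- the empty layer: `pockets(∅) ∋ min_A τ` and `d ∅` is a minimiser
        subst hN0
        have hq : (fun e : Sym2 (Fin n) => if (∀ y ∈ e, y ∈ (∅ : Finset (Fin n))) ∧ ¬ e.IsDiag then 1 else if (∃ y ∈ e, y ∈ S) then 0 else u e) = (fun e : Sym2 (Fin n) => if (∃ y ∈ e, y ∈ S) then (0 : unitInterval) else u e) := wbk_q_empty u S
        rw [hq]
        have hreach : (⋃ v ∈ (∅ : Finset (Fin n)), (openConn v b : Set (BondConfig (Fin n)))) = ∅ := by simp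
        rw [hreach, measureReal_empty, zero_add]
        suffices hgoal : (prodBernoulli (fun e : Sym2 (Fin n) => if (∃ y ∈ e, y ∈ S) then (0 : unitInterval) else u e)).real (openConn (d ∅) b) ≤ (∑ W ∈ (Finset.univ : Finset (Finset (Fin n))).filter (fun W => Disjoint W A),
                (prodBernoulli (fun e : Sym2 (Fin n) => if (∃ y ∈ e, y ∈ S) then (0 : unitInterval) else u e)).real
                    {ω : BondConfig (Fin n) | ∀ z : Fin n, (z ∈ W ↔ ω ∈ ⋃ v ∈ (∅ : Finset (Fin n)), openConn v z)}
                  * A.inf' ⟨b, hb⟩ (fun a => (prodBernoulli (fun e : Sym2 (Fin n) => if (∃ y ∈ e, y ∈ S) then (0 : unitInterval) else u e)).real (openConnIn ((W : Set (Fin n))ᶜ) a b))) by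
          linarith
        have hev1 : {ω : BondConfig (Fin n) | ∀ z : Fin n, (z ∈ (∅ : Finset (Fin n)) ↔ ω ∈ ⋃ v ∈ (∅ : Finset (Fin n)), openConn v z)}
            = Set.univ := by
          ext ω; simp
        have h0A : (∅ : Finset (Fin n)) ∈ (Finset.univ : Finset (Finset (Fin n))).filter (fun W => Disjoint W A) := by
          simp
        refine le_trans ?_ (Finset.single_le_sum (fun W _ => mul_nonneg measureReal_nonneg
          (Finset.le_inf' _ _ fun a _ => measureReal_nonneg)) h0A)
        rw [hev1, probReal_univ, one_mul]
        refine Finset.le_inf' _ _ fun a ha => ?_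
        have huniv : (openConnIn (((∅ : Finset (Fin n)) : Set (Fin n))ᶜ) a b : Set (BondConfig (Fin n))) = openConn a b := by
          ext ω
          rw [Finset.coe_empty, Set.compl_empty]
          exact (BlockExploration.mem_openConn_iff_openConnIn_univ).symm
        rw [huniv]
        exact hd0 a ha
      · have hNne : N.Nonempty := Finset.nonempty_iff_ne_empty.2 hN0
        have hgoodw := hblk (w N) (hwcard N hNA hNne hmz) A N b (d N) hb hNA (hdA N) (hwmin N hNA hNne hmz)
        have hag : ∀ e : Sym2 (Fin n), ¬ ((∀ y ∈ e, y ∈ N) ∧ ¬ e.IsDiag) → ¬ (d N ∈ e ∧ ∃ y ∈ e, y ∈ N) →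
            w N e = (fun e : Sym2 (Fin n) => if (∃ y ∈ e, y ∈ S) then (0 : unitInterval) else u e) e := by
          intro e h1 h2
          rw [hwagree N hNA hNne hmz e h1 h2, if_neg hmode]
        have hgood := blockSlack_transfer (fun e : Sym2 (Fin n) => if (∃ y ∈ e, y ∈ S) then (0 : unitInterval) else u e) (w N) A N b (d N) hb hNA (hdA N) hag (hwpos N hNA hNne hmz) hgoodw
        have hgd := blockGrowth_glue_real_openConn (fun e : Sym2 (Fin n) => if (∃ y ∈ e, y ∈ S) then (0 : unitInterval) else u e) N (d N) b
        have hg1 := blockGrowth_glue_real_openConn (fun e : Sym2 (Fin n) => if (∃ y ∈ e, y ∈ S) then (0 : unitInterval) else u e) N a₀ b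
        have hg2 := blockGrowth_glue_real_iUnion (fun e : Sym2 (Fin n) => if (∃ y ∈ e, y ∈ S) then (0 : unitInterval) else u e) N b
        have hg3 := bk_pockets_glue (fun e : Sym2 (Fin n) => if (∃ y ∈ e, y ∈ S) then (0 : unitInterval) else u e) A N b hb
        rw [hgd, hg1, hg2, hg3]
        linarith [hgood]
    · -- relay layer: only the pockets are lost
      linarith
  have hle := Finset.sum_le_sum fun N (_ : N ∈ (Finset.univ : Finset (Finset (Fin n)))) => hterm N
  rw [Finset.sum_sub_distrib, Finset.sum_add_distrib] at hle
  linarith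

/-- **The WB⁺⁺⁺ kernel, composed**: `wholeBlockKernel3_of` with the landed whole-block σ-identities
`stub_wholeBlockReach_c5`, `stub_wholeBlockDesignated_c5`, `stub_wholeBlockPockets_c5` and the isolated block `stub_isolatedBlock_c5`.
[cite: KozmaNitzan2024, §3.2 Thms 4–5 pp. 12–14] -/
theorem wholeBlockKernel3 :
    ∀ (n : ℕ) (u : Sym2 (Fin n) → unitInterval) (A S : Finset (Fin n)) (b a₀ : Fin n) (hb : b ∈ A)
      (d : Finset (Fin n) → Fin n) (w : Finset (Fin n) → Sym2 (Fin n) → unitInterval) (modeB : Finset (Fin n) → Bool),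
      Disjoint S A → a₀ ∈ A →
      (∀ a ∈ A, (prodBernoulli u).real (openConn a₀ b) ≤ (prodBernoulli u).real (openConn a b)) →
      (∀ N : Finset (Fin n), d N ∈ A) →
      modeB ∅ = false →
      (∀ a ∈ A, (prodBernoulli (fun e : Sym2 (Fin n) => if (∃ y ∈ e, y ∈ S) then (0 : unitInterval) else u e)).real (openConn (d ∅) b) ≤ (prodBernoulli (fun e : Sym2 (Fin n) => if (∃ y ∈ e, y ∈ S) then (0 : unitInterval) else u e)).real (openConn a b)) →
      (∀ N : Finset (Fin n), Disjoint N A → N.Nonempty → (prodBernoulli (fun e : Sym2 (Fin n) => if (∀ y ∈ e, y ∈ S) ∧ ¬ e.IsDiag then 1 else u e)).real {ω : BondConfig (Fin n) | ∀ y : Fin n, y ∈ N ↔ (y ∉ S ∧ ∃ o ∈ S, s(o, y) ∈ ω)} ≠ 0 →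
        ∀ a ∈ A, (prodBernoulli (w N)).real (openConn (d N) b) ≤ (prodBernoulli (w N)).real (openConn a b)) →
      (∀ N : Finset (Fin n), Disjoint N A → N.Nonempty → (prodBernoulli (fun e : Sym2 (Fin n) => if (∀ y ∈ e, y ∈ S) ∧ ¬ e.IsDiag then 1 else u e)).real {ω : BondConfig (Fin n) | ∀ y : Fin n, y ∈ N ↔ (y ∉ S ∧ ∃ o ∈ S, s(o, y) ∈ ω)} ≠ 0 →
        (Finset.univ.filter (fun v : Fin n => ∃ y : Fin n, 0 < (w N s(y, v) : ℝ))).card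
          < (Finset.univ.filter (fun v : Fin n => ∃ y : Fin n, 0 < (u s(y, v) : ℝ))).card) →
      (∀ N : Finset (Fin n), Disjoint N A → N.Nonempty → (prodBernoulli (fun e : Sym2 (Fin n) => if (∀ y ∈ e, y ∈ S) ∧ ¬ e.IsDiag then 1 else u e)).real {ω : BondConfig (Fin n) | ∀ y : Fin n, y ∈ N ↔ (y ∉ S ∧ ∃ o ∈ S, s(o, y) ∈ ω)} ≠ 0 → ∀ e : Sym2 (Fin n),
        ¬ ((∀ y ∈ e, y ∈ N) ∧ ¬ e.IsDiag) → ¬ (d N ∈ e ∧ ∃ y ∈ e, y ∈ N) →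
        w N e = (if modeB N = true then (fun e : Sym2 (Fin n) => if a₀ ∈ e ∧ (∃ y ∈ e, y ∈ N) then (0 : unitInterval) else if (∃ y ∈ e, y ∈ S) then 0 else u e) e else (fun e : Sym2 (Fin n) => if (∃ y ∈ e, y ∈ S) then (0 : unitInterval) else u e) e)) →
      (∀ N : Finset (Fin n), Disjoint N A → N.Nonempty → (prodBernoulli (fun e : Sym2 (Fin n) => if (∀ y ∈ e, y ∈ S) ∧ ¬ e.IsDiag then 1 else u e)).real {ω : BondConfig (Fin n) | ∀ y : Fin n, y ∈ N ↔ (y ∉ S ∧ ∃ o ∈ S, s(o, y) ∈ ω)} ≠ 0 →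
        0 < (prodBernoulli (w N)).real {ω : BondConfig (Fin n) | ∀ y ∈ N, s(d N, y) ∉ ω}) →
      (∀ w' : Sym2 (Fin n) → unitInterval,
        (Finset.univ.filter (fun v : Fin n => ∃ y : Fin n, 0 < (w' s(y, v) : ℝ))).card
          < (Finset.univ.filter (fun v : Fin n => ∃ y : Fin n, 0 < (u s(y, v) : ℝ))).card →
        ∀ (A' S' : Finset (Fin n)) (b' d' : Fin n) (hb' : b' ∈ A'), Disjoint S' A' → d' ∈ A' →
        (∀ a ∈ A', (prodBernoulli w').real (openConn d' b') ≤ (prodBernoulli w').real (openConn a b')) →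
        (prodBernoulli w').real (openConn d' b')
          + (prodBernoulli w').real
              ((openConn d' b')ᶜ ∩ (⋃ v ∈ S', openConn d' v) ∩ (⋃ v ∈ S', openConn v b'))
        ≤ (prodBernoulli w').real (⋃ v ∈ S', openConn v b')
          + (∑ W ∈ (Finset.univ : Finset (Finset (Fin n))).filter (fun W => Disjoint W A'),
              (prodBernoulli w').real
                  {ω : BondConfig (Fin n) | ∀ z : Fin n, (z ∈ W ↔ ω ∈ ⋃ v ∈ S', openConn v z)}
                * A'.inf' ⟨b', hb'⟩ (fun a => (prodBernoulli w').real (openConnIn ((W : Set (Fin n))ᶜ) a b')))) →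
      0 ≤ ∑ N : Finset (Fin n), (prodBernoulli (fun e : Sym2 (Fin n) => if (∀ y ∈ e, y ∈ S) ∧ ¬ e.IsDiag then 1 else u e)).real {ω : BondConfig (Fin n) | ∀ y : Fin n, y ∈ N ↔ (y ∉ S ∧ ∃ o ∈ S, s(o, y) ∈ ω)}
          * (if Disjoint N A then
              (if modeB N = true then
                  (prodBernoulli (fun e : Sym2 (Fin n) => if (∃ y ∈ e, y ∈ S) then (0 : unitInterval) else u e)).real {ω : BondConfig (Fin n) | ∀ y ∈ N, s(a₀, y) ∉ ω}
                    * ((prodBernoulli (fun e : Sym2 (Fin n) => if (∀ y ∈ e, y ∈ N) ∧ ¬ e.IsDiag then 1 else if a₀ ∈ e ∧ (∃ y ∈ e, y ∈ N) then (0 : unitInterval) else if (∃ y ∈ e, y ∈ S) then 0 else u e)).real (openConn (d N) b) - (prodBernoulli (fun e : Sym2 (Fin n) => if (∀ y ∈ e, y ∈ N) ∧ ¬ e.IsDiag then 1 else if a₀ ∈ e ∧ (∃ y ∈ e, y ∈ N) then (0 : unitInterval) else if (∃ y ∈ e, y ∈ S) then 0 else u e)).real (openConn a₀ b))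
                else ((prodBernoulli (fun e : Sym2 (Fin n) => if (∀ y ∈ e, y ∈ N) ∧ ¬ e.IsDiag then 1 else if (∃ y ∈ e, y ∈ S) then 0 else u e)).real (openConn (d N) b) - (prodBernoulli (fun e : Sym2 (Fin n) => if (∀ y ∈ e, y ∈ N) ∧ ¬ e.IsDiag then 1 else if (∃ y ∈ e, y ∈ S) then 0 else u e)).real (openConn a₀ b)))
            else
              ((prodBernoulli (fun e : Sym2 (Fin n) => if (∀ y ∈ e, y ∈ N) ∧ ¬ e.IsDiag then 1 else if (∃ y ∈ e, y ∈ S) then 0 else u e)).real (⋃ v ∈ N, openConn v b) - (prodBernoulli (fun e : Sym2 (Fin n) => if (∀ y ∈ e, y ∈ N) ∧ ¬ e.IsDiag then 1 else if (∃ y ∈ e, y ∈ S) then 0 else u e)).real (openConn a₀ b))) →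
      (prodBernoulli u).real (openConn a₀ b)
            + (prodBernoulli u).real ((openConn a₀ b)ᶜ ∩ (⋃ v ∈ S, openConn a₀ v) ∩ (⋃ v ∈ S, openConn v b))
          ≤ (prodBernoulli u).real (⋃ v ∈ S, openConn v b)
            + (∑ W ∈ (Finset.univ : Finset (Finset (Fin n))).filter (fun W => Disjoint W A),
                (prodBernoulli u).real
                    {ω : BondConfig (Fin n) | ∀ z : Fin n, (z ∈ W ↔ ω ∈ ⋃ v ∈ S, openConn v z)}
                  * A.inf' ⟨b, hb⟩ (fun a => (prodBernoulli u).real (openConnIn ((W : Set (Fin n))ᶜ) a b))) :=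
  wholeBlockKernel3_of stub_wholeBlockReach_c5 stub_wholeBlockDesignated_c5 stub_wholeBlockPockets_c5 stub_isolatedBlock_c5

end WholeBlockKernel3

end

end Summit.CriticalPhenomena.PercolationContinuityZ3.Theorems
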